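import Mathlib
import HarnessLib
import Summits.Ventures.LatticeQCDFlow.Exactness.SUNJitteredHMCCertificates
import Summits.Ventures.LatticeQCDFlow.Exactness.NCMCGeneralSpaceDoeblinPowerCLT
import Summits.Ventures.LatticeQCDFlow.Scoring.DoeblinPowerBatchMeansCLT
import Summits.Ventures.LatticeQCDFlow.Scoring.DoeblinPowerBatchMeansTauInt

/-!
# The engine's DEFAULT `'hmc' + n_or × 'or'` composite on `SU(N)` as run (fixed short trajectory, `tau_jitter = 0`) — and the fixed-step HMC followed by ANY exact step: Doeblin certificate, every event a finite `τ_int`, certified burn-in, CLT and asymptotically exact batch-means error bars from EVERY start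

HONEST FRAMING: exact (Metropolis-corrected) sampling algorithms for lattice gauge theory;
figures of merit are autocorrelation/cost numbers at stated couplings and volumes; no
continuum-physics claim.

Venture `LatticeQCDFlow` (cell pub-lqcd), topic `Exactness`, FANOUT row 9 (eng-latcore, GEN-23; the engine
`latflow.core.updates.composite_sweep(f, β, 'hmc', n_or)` with `hmc.HMC(f, β, 'leapfrog').trajectory(τ, nstep)` at its
DEFAULT `tau_jitter = 0`: one `nstep`-step leapfrog trajectory of length `τ = nstep·ε` with the engine's momenta,
kinetic term, Wilson force law and Metropolis test, then `n_or` Cabibbo–Marinari over-relaxation sweeps).  NEW WORK of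
the cell over the tree, nothing cited as a fact, no number claimed: gen-22's `SUNJitteredHMCExactStep.lean`
(`engine_sunLeapfrogHMCN_box_minorised_of_trajLength` — the fixed-step update dominates product Haar on a box around
every configuration for `nstep·ε ≤ τ₀`), GEN-23's `SUNJitteredHMCCertificates.lean` (`exactStep_nHit_minorised_of_box_minorised`),
gen-18's `SUNMultiStepLeapfrogHMC*.lean` (`sunLeapfrogHMCN`, `sunLeapfrogHMCN_invariant_gibbs`), gen-21's
`SUNLeapfrogHMCORSweepErgodic.lean` (convergence of this composite, constant inside the proof), `CabibboMarinariORSweep.lean`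
(`cmORSweep_invariant`), rows 13 / 8 (`…_of_nHit` consequences); row 21's `Scoring/SUNMultiStepLeapfrogHMCBatchMeans.lean`
is the HMC ALONE.  Printed counterparts NAMED ONLY: Duane–Kennedy–Pendleton–Roweth 1987; Creutz 1987 / Brown–Woch 1987;
Meyn–Tweedie 1993; Flegal–Jones 2010; Madras–Sokal 1988.

## Content (torus `(ℤ/L)^d`, `G = SU(N)`, `N, L ≥ 1`, any real `β`, `π = wilsonMeasure (β/N)`; every theorem:
## `∃ τ₀ > 0` on `N, d, L, β` only, then for EVERY `nstep ≥ 1`, `ε > 0` with `nstep·ε ≤ τ₀` and EVERY Markov `P` leaving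
## `π` invariant — the OR sweeps `cmORSweep sched` (`L ≥ 2`), a heat-bath sweep, nothing (`P` = identity) …)

* **`wilson_sunLeapfrogHMCN_exactStep_certificate`** — `P ∘ₖ K` leaves `π` invariant and `ε' • π ≤ (P ∘ₖ K)^m(U, ·)`
  for EVERY `U`, `m > 0`, `0 < ε' ≤ 1`; **`wilson_sunLeapfrogHMCN_orSweep_certificate`** (`P = cmORSweep sched`).
* **`wilson_sunLeapfrogHMCN_exactStep_tauInt_setACF_le`** (ONE `B`: `τ_int(1_A) ≤ 1/2 + B/(1 − π(A))` for EVERY event),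
  **`…_exactStep_timeAverage_bias_le`** (burn-in `B/n` from EVERY start), **`…_exactStep_timeAverage_clt`**,
  **`…_exactStep_batchMeans_tendstoInMeasure`**, **`…_exactStep_batchMeans_coverage`** (`σ²_f > 0`),
  **`…_exactStep_tauInt_tendstoInMeasure`** (`Var_π f ≠ 0`).

NOT CLAIMED: anything for `nstep·ε > τ₀` (long fixed trajectories can be non-ergodic — row 2's free-field resonance;
the engine's `tau_jitter` remedy is GEN-22/23's `SUNJitteredHMC*.lean`); any value of `τ₀, m, ε', B`; OMF words;
floating point.
-/

noncomputable section

namespace Summit.Ventures.LatticeQCDFlow.Exactness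

open MeasureTheory ProbabilityTheory ProbabilityTheory.Kernel Set Function Filter Topology
open Literature.MathematicalPhysics.QuantumFieldTheory
open Literature.MathematicalPhysics.QuantumLattice (fundamentalRep continuous_fundamentalRep connectedSpace_specialUnitaryGroup)
open Summit.Ventures.LatticeQCDFlow.Scoring (replicaSEsq tauInt autocov)
open scoped ENNReal Matrix Matrix.Norms.Operator NNReal

set_option backward.isDefEq.respectTransparency false

section FixedStep

variable (N : ℕ) [NeZero N] {d L : ℕ} [NeZero L] (β : ℝ)

/-- **THE DOEBLIN CERTIFICATE OF THE ENGINE'S FIXED-STEP `SU(N)` HMC FOLLOWED BY ANY EXACT STEP.**  There is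
`τ₀ > 0` (on `N, d, L, β` only) such that for EVERY `nstep ≥ 1`, `ε > 0` with `nstep·ε ≤ τ₀` and EVERY Markov kernel
`P` leaving `wilsonMeasure (β/N)` invariant, `P ∘ₖ K` leaves it invariant and some power dominates
`ε' · wilsonMeasure (β/N)` from EVERY configuration (`m > 0`, `0 < ε' ≤ 1`). -/
theorem wilson_sunLeapfrogHMCN_exactStep_certificate :
    ∃ τ₀ : ℝ, 0 < τ₀ ∧ ∀ (nstep : ℕ) (ε : ℝ), 1 ≤ nstep → 0 < ε → nstep * ε ≤ τ₀ →
      ∀ (P : Kernel (GaugeConfig d L (Matrix.specialUnitaryGroup (Fin N) ℂ)) (GaugeConfig d L (Matrix.specialUnitaryGroup (Fin N) ℂ)))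
        [IsMarkovKernel P], Invariant P (wilsonMeasure (d := d) (L := L) (fundamentalRep (Fin N)) (β / N)) →
      Invariant (P ∘ₖ (sunLeapfrogHMCN (sunCoordι N) (sunCoordι_skew N) ε (Measure.addHaar : Measure (SUNCoords N))
                  (sunKinetic N) (measurable_halfKick_sun N (measurable_sunWilsonForceLaw_coeConfig N (d := d) (L := L) β) ε)
                  (fun U => β / N * wilsonAction (fundamentalRep (Fin N)) U) nstep)) (wilsonMeasure (d := d) (L := L) (fundamentalRep (Fin N)) (β / N)) ∧
      ∃ m : ℕ, ∃ ε' : ℝ≥0∞, 0 < m ∧ 0 < ε' ∧ ε' ≤ 1 ∧ ∀ U : GaugeConfig d L (Matrix.specialUnitaryGroup (Fin N) ℂ),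
        ε' • wilsonMeasure (d := d) (L := L) (fundamentalRep (Fin N)) (β / N) ≤
          nHit (P ∘ₖ (sunLeapfrogHMCN (sunCoordι N) (sunCoordι_skew N) ε (Measure.addHaar : Measure (SUNCoords N))
                  (sunKinetic N) (measurable_halfKick_sun N (measurable_sunWilsonForceLaw_coeConfig N (d := d) (L := L) β) ε)
                  (fun U => β / N * wilsonAction (fundamentalRep (Fin N)) U) nstep)) m U := by
  haveI : ConnectedSpace (Matrix.specialUnitaryGroup (Fin N) ℂ) := connectedSpace_specialUnitaryGroup
  obtain ⟨s, hs⟩ := exists_bound_smul_wilsonAction_sun N (d := d) (L := L) _ (continuous_fundamentalRep (Fin N)) (β / N)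
  obtain ⟨Fmax, KF, hF0, hKF0, hFb, hFK⟩ := sunWilsonForceLaw_bounds N (d := d) (L := L) β
  obtain ⟨τ₀, hτ₀, hbox⟩ := engine_sunLeapfrogHMCN_box_minorised_of_trajLength N
    (measurable_sunWilsonForceLaw_coeConfig N (d := d) (L := L) β) hF0 hFb hKF0 hFK (measurable_engineWilsonAction N β) hs
  refine ⟨τ₀, hτ₀, fun nstep ε hn hε hτ P _ hP => ?_⟩
  obtain ⟨V, hVo, hV1, κ, hκ, hK⟩ := hbox nstep ε hn hε hτ
  have hT := measurable_sunKinetic (L := Edge d L) N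
  have hZ := sunMomentumWeight_sunKinetic_ne_top (L := Edge d L) N (Measure.addHaar : Measure (SUNCoords N))
  haveI : Fact (Measurable fun z : (GaugeConfig d L (Matrix.specialUnitaryGroup (Fin N) ℂ)) × (Edge d L → SUNCoords N) =>
      β / N * wilsonAction (fundamentalRep (Fin N)) z.1 + sunKinetic N z.2) :=
    ⟨((measurable_engineWilsonAction N β).comp measurable_fst).add (hT.comp measurable_snd)⟩
  haveI := isProbabilityMeasure_sunMomentumLaw (L := Edge d L) (Measure.addHaar : Measure (SUNCoords N)) (sunKinetic N) hT hZ
  haveI : IsMarkovKernel (sunLeapfrogHMCN (sunCoordι N) (sunCoordι_skew N) ε (Measure.addHaar : Measure (SUNCoords N))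
                  (sunKinetic N) (measurable_halfKick_sun N (measurable_sunWilsonForceLaw_coeConfig N (d := d) (L := L) β) ε)
                  (fun U => β / N * wilsonAction (fundamentalRep (Fin N)) U) nstep) := by
    unfold sunLeapfrogHMCN; infer_instance
  have hKinv : Invariant (sunLeapfrogHMCN (sunCoordι N) (sunCoordι_skew N) ε (Measure.addHaar : Measure (SUNCoords N))
                  (sunKinetic N) (measurable_halfKick_sun N (measurable_sunWilsonForceLaw_coeConfig N (d := d) (L := L) β) ε)
                  (fun U => β / N * wilsonAction (fundamentalRep (Fin N)) U) nstep) (wilsonMeasure (d := d) (L := L) (fundamentalRep (Fin N)) (β / N)) := by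
    rw [← gibbsProbability_smul_wilsonAction_eq N (d := d) (L := L) (fundamentalRep (Fin N)) (β / N)]
    exact sunLeapfrogHMCN_invariant_gibbs (sunCoordι N) (sunCoordι_skew N) _ hT hZ (measurable_engineWilsonAction N β) nstep
  refine ⟨hP.comp hKinv, ?_⟩
  obtain ⟨hlo, hhi⟩ := gibbsWeight_pinched (L := Edge d L) (n := Fin N) hs
  have heq := gibbsProbability_smul_wilsonAction_eq N (d := d) (L := L) (fundamentalRep (Fin N)) (β / N)
  rw [← heq] at hP
  obtain ⟨mm, a, ha, hmin⟩ := exactStep_nHit_minorised_of_box_minorised (Real.exp_pos (-s)) hlo hhi hVo hV1 hκ hK P hP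
  rw [heq] at hmin
  haveI : IsMarkovKernel (nHit (P ∘ₖ (sunLeapfrogHMCN (sunCoordι N) (sunCoordι_skew N) ε (Measure.addHaar : Measure (SUNCoords N))
                  (sunKinetic N) (measurable_halfKick_sun N (measurable_sunWilsonForceLaw_coeConfig N (d := d) (L := L) β) ε)
                  (fun U => β / N * wilsonAction (fundamentalRep (Fin N)) U) nstep)) (mm + 1)) := isMarkovKernel_nHit _ _
  have ha1 : a ≤ 1 := by
    have h1 := Measure.le_iff'.1 (hmin fun _ => 1) univ
    rwa [Measure.smul_apply, smul_eq_mul, measure_univ, measure_univ, mul_one] at h1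
  exact ⟨mm + 1, a, Nat.succ_pos mm, pos_iff_ne_zero.2 ha, ha1, hmin⟩

variable {mC : Type*} [Fintype mC] [DecidableEq mC]

/-- **THE DOEBLIN CERTIFICATE OF THE ENGINE'S DEFAULT `'hmc' + n_or × 'or'` COMPOSITE AS RUN** (`L ≥ 2`, fixed
trajectory `nstep·ε ≤ τ₀`, `P` = ANY schedule of Cabibbo–Marinari over-relaxation hits). -/
theorem wilson_sunLeapfrogHMCN_orSweep_certificate (hL : 2 ≤ L) :
    ∃ τ₀ : ℝ, 0 < τ₀ ∧ ∀ (nstep : ℕ) (ε : ℝ), 1 ≤ nstep → 0 < ε → nstep * ε ≤ τ₀ →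
      ∀ (sched : List (Edge d L × (Fin N ≃ Fin 2 ⊕ mC))),
      Invariant (cmORSweep sched ∘ₖ (sunLeapfrogHMCN (sunCoordι N) (sunCoordι_skew N) ε (Measure.addHaar : Measure (SUNCoords N))
                  (sunKinetic N) (measurable_halfKick_sun N (measurable_sunWilsonForceLaw_coeConfig N (d := d) (L := L) β) ε)
                  (fun U => β / N * wilsonAction (fundamentalRep (Fin N)) U) nstep)) (wilsonMeasure (d := d) (L := L) (fundamentalRep (Fin N)) (β / N)) ∧
      ∃ m : ℕ, ∃ ε' : ℝ≥0∞, 0 < m ∧ 0 < ε' ∧ ε' ≤ 1 ∧ ∀ U : GaugeConfig d L (Matrix.specialUnitaryGroup (Fin N) ℂ),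
        ε' • wilsonMeasure (d := d) (L := L) (fundamentalRep (Fin N)) (β / N) ≤
          nHit (cmORSweep sched ∘ₖ (sunLeapfrogHMCN (sunCoordι N) (sunCoordι_skew N) ε (Measure.addHaar : Measure (SUNCoords N))
                  (sunKinetic N) (measurable_halfKick_sun N (measurable_sunWilsonForceLaw_coeConfig N (d := d) (L := L) β) ε)
                  (fun U => β / N * wilsonAction (fundamentalRep (Fin N)) U) nstep)) m U := by
  obtain ⟨τ₀, hτ₀, h⟩ := wilson_sunLeapfrogHMCN_exactStep_certificate N (d := d) (L := L) β
  refine ⟨τ₀, hτ₀, fun nstep ε hn hε hτ sched => h nstep ε hn hε hτ (cmORSweep sched) ?_⟩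
  rw [← gibbsProbability_smul_wilsonAction_eq N (d := d) (L := L) (fundamentalRep (Fin N)) (β / N)]
  refine invariant_gibbsProbability ?_
  have hdens : (fun U : GaugeConfig d L (Matrix.specialUnitaryGroup (Fin N) ℂ) => ENNReal.ofReal (Real.exp (-(β / N * wilsonAction (fundamentalRep (Fin N)) U)))) =
      gibbsDensity fun U : GaugeConfig d L (Matrix.specialUnitaryGroup (Fin N) ℂ) => β / N * wilsonAction (suRep N) U := by
    funext U; rfl
  rw [hdens]
  exact cmORSweep_invariant (β / N) hL sched

/-! ## Figures of merit of `P ∘ K` (every exact `P`; the OR sweeps in particular) -/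

/-- **EVERY EVENT HAS A FINITE `τ_int` UNDER THE FIXED-STEP HMC + ANY EXACT STEP — ONE CONSTANT FOR ALL EVENTS**:
`B ≥ 0` with `τ_int(1_A) ≤ 1/2 + B/(1 − π(A))` for EVERY measurable `A` with `0 < π(A) < 1`. -/
theorem wilson_sunLeapfrogHMCN_exactStep_tauInt_setACF_le :
    ∃ τ₀ : ℝ, 0 < τ₀ ∧ ∀ (nstep : ℕ) (ε : ℝ), 1 ≤ nstep → 0 < ε → nstep * ε ≤ τ₀ →
      ∀ (P : Kernel (GaugeConfig d L (Matrix.specialUnitaryGroup (Fin N) ℂ)) (GaugeConfig d L (Matrix.specialUnitaryGroup (Fin N) ℂ)))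
        [IsMarkovKernel P], Invariant P (wilsonMeasure (d := d) (L := L) (fundamentalRep (Fin N)) (β / N)) →
      ∃ B : ℝ, 0 ≤ B ∧ ∀ A : Set (GaugeConfig d L (Matrix.specialUnitaryGroup (Fin N) ℂ)), MeasurableSet A →
        0 < (wilsonMeasure (d := d) (L := L) (fundamentalRep (Fin N)) (β / N)).real A → (wilsonMeasure (d := d) (L := L) (fundamentalRep (Fin N)) (β / N)).real A < 1 →
        tauInt (setACF (P ∘ₖ (sunLeapfrogHMCN (sunCoordι N) (sunCoordι_skew N) ε (Measure.addHaar : Measure (SUNCoords N))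
                  (sunKinetic N) (measurable_halfKick_sun N (measurable_sunWilsonForceLaw_coeConfig N (d := d) (L := L) β) ε)
                  (fun U => β / N * wilsonAction (fundamentalRep (Fin N)) U) nstep)) (wilsonMeasure (d := d) (L := L) (fundamentalRep (Fin N)) (β / N)) A) ≤ 1 / 2 + B / (1 - (wilsonMeasure (d := d) (L := L) (fundamentalRep (Fin N)) (β / N)).real A) := by
  obtain ⟨τ₀, hτ₀, h⟩ := wilson_sunLeapfrogHMCN_exactStep_certificate N (d := d) (L := L) β
  refine ⟨τ₀, hτ₀, fun nstep ε hn hε hτ P _ hP => ?_⟩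
  obtain ⟨hinv, m, ε', hm, hε0, hε1, hmin⟩ := h nstep ε hn hε hτ P hP
  haveI : Fact (Measurable fun z : (GaugeConfig d L (Matrix.specialUnitaryGroup (Fin N) ℂ)) × (Edge d L → SUNCoords N) =>
      β / N * wilsonAction (fundamentalRep (Fin N)) z.1 + sunKinetic N z.2) :=
    ⟨((measurable_engineWilsonAction N β).comp measurable_fst).add ((measurable_sunKinetic N).comp measurable_snd)⟩
  haveI := isProbabilityMeasure_sunMomentumLaw (L := Edge d L) (Measure.addHaar : Measure (SUNCoords N)) (sunKinetic N)
    (measurable_sunKinetic N) (sunMomentumWeight_sunKinetic_ne_top N Measure.addHaar)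
  haveI : IsMarkovKernel (sunLeapfrogHMCN (sunCoordι N) (sunCoordι_skew N) ε (Measure.addHaar : Measure (SUNCoords N))
                  (sunKinetic N) (measurable_halfKick_sun N (measurable_sunWilsonForceLaw_coeConfig N (d := d) (L := L) β) ε)
                  (fun U => β / N * wilsonAction (fundamentalRep (Fin N)) U) nstep) := by
    unfold sunLeapfrogHMCN; infer_instance
  have he0 : 0 < ε'.toReal := ENNReal.toReal_pos hε0.ne' (ne_top_of_le_ne_top ENNReal.one_ne_top hε1)
  have he1 : ε'.toReal ≤ 1 := ENNReal.toReal_le_of_le_ofReal zero_le_one (by simpa using hε1)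
  have hm1 : (1 : ℝ) ≤ m := by exact_mod_cast hm
  refine ⟨(m : ℝ) / ε'.toReal - 1, ?_, fun A hA h0 h1 => ?_⟩
  · rw [sub_nonneg, le_div_iff₀ he0]; nlinarith
  · exact GeneralNCMC.tauInt_setACF_le_of_nHit (GeneralNCMC.minorised_setwise hmin) hε0 hε1 hm hinv hA h0 h1

/-- **CERTIFIED BURN-IN OF THE FIXED-STEP HMC + ANY EXACT STEP FROM EVERY START**: one `B ≥ 0` with
`|E_{μ₀}[(1/n) Σ_{t<n} g(U_t)] − ∫ g dπ| ≤ B/n` for EVERY initial law, every `[0,1]`-valued measurable `g`, `n ≥ 1`. -/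
theorem wilson_sunLeapfrogHMCN_exactStep_timeAverage_bias_le :
    ∃ τ₀ : ℝ, 0 < τ₀ ∧ ∀ (nstep : ℕ) (ε : ℝ), 1 ≤ nstep → 0 < ε → nstep * ε ≤ τ₀ →
      ∀ (P : Kernel (GaugeConfig d L (Matrix.specialUnitaryGroup (Fin N) ℂ)) (GaugeConfig d L (Matrix.specialUnitaryGroup (Fin N) ℂ)))
        [IsMarkovKernel P], Invariant P (wilsonMeasure (d := d) (L := L) (fundamentalRep (Fin N)) (β / N)) →
      ∀ [IsMarkovKernel (sunLeapfrogHMCN (sunCoordι N) (sunCoordι_skew N) ε (Measure.addHaar : Measure (SUNCoords N))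
                  (sunKinetic N) (measurable_halfKick_sun N (measurable_sunWilsonForceLaw_coeConfig N (d := d) (L := L) β) ε)
                  (fun U => β / N * wilsonAction (fundamentalRep (Fin N)) U) nstep)],
      ∃ B : ℝ, 0 ≤ B ∧ ∀ (μ₀ : Measure (GaugeConfig d L (Matrix.specialUnitaryGroup (Fin N) ℂ))) [IsProbabilityMeasure μ₀]
        (g : GaugeConfig d L (Matrix.specialUnitaryGroup (Fin N) ℂ) → ℝ), Measurable g → (∀ U, 0 ≤ g U) → (∀ U, g U ≤ 1) → ∀ n : ℕ, n ≠ 0 →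
        |∫ x, (∑ t ∈ Finset.range n, g (x t)) / n
            ∂(Kernel.trajMeasure (X := fun _ : ℕ => GaugeConfig d L (Matrix.specialUnitaryGroup (Fin N) ℂ)) μ₀
              (fun t : ℕ => (P ∘ₖ (sunLeapfrogHMCN (sunCoordι N) (sunCoordι_skew N) ε (Measure.addHaar : Measure (SUNCoords N))
                  (sunKinetic N) (measurable_halfKick_sun N (measurable_sunWilsonForceLaw_coeConfig N (d := d) (L := L) β) ε)
                  (fun U => β / N * wilsonAction (fundamentalRep (Fin N)) U) nstep)).comap
                (fun h : (i : ↥(Finset.Iic t)) → GaugeConfig d L (Matrix.specialUnitaryGroup (Fin N) ℂ) =>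
                  h ⟨t, Finset.mem_Iic.2 le_rfl⟩) (measurable_pi_apply _)))
          - ∫ U, g U ∂(wilsonMeasure (d := d) (L := L) (fundamentalRep (Fin N)) (β / N))| ≤ B / n := by
  obtain ⟨τ₀, hτ₀, h⟩ := wilson_sunLeapfrogHMCN_exactStep_certificate N (d := d) (L := L) β
  refine ⟨τ₀, hτ₀, fun nstep ε hn hε hτ P _ hP _ => ?_⟩
  obtain ⟨hinv, m, ε', hm, hε0, hε1, hmin⟩ := h nstep ε hn hε hτ P hP
  have he0 : 0 < ε'.toReal := ENNReal.toReal_pos hε0.ne' (ne_top_of_le_ne_top ENNReal.one_ne_top hε1)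
  refine ⟨(m : ℝ) / ε'.toReal, by positivity, fun μ₀ _ g hg h0 h1 n hn0 => ?_⟩
  calc _ ≤ (m : ℝ) / (ε'.toReal * n) :=
        GeneralNCMC.chain_timeAverage_bias_le_of_nHit (GeneralNCMC.minorised_setwise hmin) hε0 hε1 hm hinv μ₀
          hg h0 h1 hn0
    _ = (m : ℝ) / ε'.toReal / n := by rw [div_div]

/-- **THE CLT FOR TIME AVERAGES OF THE FIXED-STEP HMC + ANY EXACT STEP, FROM EVERY INITIAL LAW** (`|f| ≤ C`
measurable, `Y ~ N(0, σ²_f)`): `(√n)⁻¹ Σ_{t<n} (f(U_t) − π f) ⇒ Y` under `P_{μ₀}`. -/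
theorem wilson_sunLeapfrogHMCN_exactStep_timeAverage_clt :
    ∃ τ₀ : ℝ, 0 < τ₀ ∧ ∀ (nstep : ℕ) (ε : ℝ), 1 ≤ nstep → 0 < ε → nstep * ε ≤ τ₀ →
      ∀ (P : Kernel (GaugeConfig d L (Matrix.specialUnitaryGroup (Fin N) ℂ)) (GaugeConfig d L (Matrix.specialUnitaryGroup (Fin N) ℂ)))
        [IsMarkovKernel P], Invariant P (wilsonMeasure (d := d) (L := L) (fundamentalRep (Fin N)) (β / N)) →
      ∀ [IsMarkovKernel (sunLeapfrogHMCN (sunCoordι N) (sunCoordι_skew N) ε (Measure.addHaar : Measure (SUNCoords N))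
                  (sunKinetic N) (measurable_halfKick_sun N (measurable_sunWilsonForceLaw_coeConfig N (d := d) (L := L) β) ε)
                  (fun U => β / N * wilsonAction (fundamentalRep (Fin N)) U) nstep)],
      ∀ (f : GaugeConfig d L (Matrix.specialUnitaryGroup (Fin N) ℂ) → ℝ), Measurable f → ∀ C : ℝ, (∀ U, |f U| ≤ C) →
      ∀ (μ₀ : Measure (GaugeConfig d L (Matrix.specialUnitaryGroup (Fin N) ℂ))) [IsProbabilityMeasure μ₀]
        [IsProbabilityMeasure (Kernel.trajMeasure (X := fun _ : ℕ => GaugeConfig d L (Matrix.specialUnitaryGroup (Fin N) ℂ)) μ₀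
              (fun t : ℕ => (P ∘ₖ (sunLeapfrogHMCN (sunCoordι N) (sunCoordι_skew N) ε (Measure.addHaar : Measure (SUNCoords N))
                  (sunKinetic N) (measurable_halfKick_sun N (measurable_sunWilsonForceLaw_coeConfig N (d := d) (L := L) β) ε)
                  (fun U => β / N * wilsonAction (fundamentalRep (Fin N)) U) nstep)).comap
                (fun h : (i : ↥(Finset.Iic t)) → GaugeConfig d L (Matrix.specialUnitaryGroup (Fin N) ℂ) =>
                  h ⟨t, Finset.mem_Iic.2 le_rfl⟩) (measurable_pi_apply _)))]
        {Ω' : Type} [MeasurableSpace Ω'] (P' : Measure Ω') [IsProbabilityMeasure P'] (Y : Ω' → ℝ),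
        HasLaw Y (gaussianReal 0 (Real.toNNReal
          ((∫ y, (f y - ∫ z, f z ∂(wilsonMeasure (d := d) (L := L) (fundamentalRep (Fin N)) (β / N))) ^ 2 ∂(wilsonMeasure (d := d) (L := L) (fundamentalRep (Fin N)) (β / N)))
              + 2 * ∑' k, ∫ y, (f y - ∫ z, f z ∂(wilsonMeasure (d := d) (L := L) (fundamentalRep (Fin N)) (β / N)))
                * (Scoring.kop (P ∘ₖ (sunLeapfrogHMCN (sunCoordι N) (sunCoordι_skew N) ε (Measure.addHaar : Measure (SUNCoords N))
                  (sunKinetic N) (measurable_halfKick_sun N (measurable_sunWilsonForceLaw_coeConfig N (d := d) (L := L) β) ε)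
                  (fun U => β / N * wilsonAction (fundamentalRep (Fin N)) U) nstep)))^[k + 1]
                  (fun y => f y - ∫ z, f z ∂(wilsonMeasure (d := d) (L := L) (fundamentalRep (Fin N)) (β / N))) y ∂(wilsonMeasure (d := d) (L := L) (fundamentalRep (Fin N)) (β / N))))) P' →
        TendstoInDistribution (fun (n : ℕ) (x : ℕ → GaugeConfig d L (Matrix.specialUnitaryGroup (Fin N) ℂ)) =>
            (Real.sqrt n)⁻¹ * ∑ t ∈ Finset.range n, (f (x t) - ∫ z, f z ∂(wilsonMeasure (d := d) (L := L) (fundamentalRep (Fin N)) (β / N))))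
          atTop Y (fun _ => (Kernel.trajMeasure (X := fun _ : ℕ => GaugeConfig d L (Matrix.specialUnitaryGroup (Fin N) ℂ)) μ₀
              (fun t : ℕ => (P ∘ₖ (sunLeapfrogHMCN (sunCoordι N) (sunCoordι_skew N) ε (Measure.addHaar : Measure (SUNCoords N))
                  (sunKinetic N) (measurable_halfKick_sun N (measurable_sunWilsonForceLaw_coeConfig N (d := d) (L := L) β) ε)
                  (fun U => β / N * wilsonAction (fundamentalRep (Fin N)) U) nstep)).comap
                (fun h : (i : ↥(Finset.Iic t)) → GaugeConfig d L (Matrix.specialUnitaryGroup (Fin N) ℂ) =>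
                  h ⟨t, Finset.mem_Iic.2 le_rfl⟩) (measurable_pi_apply _)))) P' := by
  obtain ⟨τ₀, hτ₀, h⟩ := wilson_sunLeapfrogHMCN_exactStep_certificate N (d := d) (L := L) β
  refine ⟨τ₀, hτ₀, fun nstep ε hn hε hτ P _ hP _ f hf C hC μ₀ _ _ Ω' _ P' _ Y hY => ?_⟩
  obtain ⟨hinv, m, ε', hm, hε0, -, hmin⟩ := h nstep ε hn hε hτ P hP
  exact GeneralNCMC.tendstoInDistribution_timeAverage_of_nHit hinv hε0.ne' hmin hm hf hC μ₀ hY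

/-- **BATCH MEANS ESTIMATE `σ²_f` CONSISTENTLY ALONG THE FIXED-STEP HMC + ANY EXACT STEP, FROM EVERY INITIAL LAW.** -/
theorem wilson_sunLeapfrogHMCN_exactStep_batchMeans_tendstoInMeasure :
    ∃ τ₀ : ℝ, 0 < τ₀ ∧ ∀ (nstep : ℕ) (ε : ℝ), 1 ≤ nstep → 0 < ε → nstep * ε ≤ τ₀ →
      ∀ (P : Kernel (GaugeConfig d L (Matrix.specialUnitaryGroup (Fin N) ℂ)) (GaugeConfig d L (Matrix.specialUnitaryGroup (Fin N) ℂ)))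
        [IsMarkovKernel P], Invariant P (wilsonMeasure (d := d) (L := L) (fundamentalRep (Fin N)) (β / N)) →
      ∀ [IsMarkovKernel (sunLeapfrogHMCN (sunCoordι N) (sunCoordι_skew N) ε (Measure.addHaar : Measure (SUNCoords N))
                  (sunKinetic N) (measurable_halfKick_sun N (measurable_sunWilsonForceLaw_coeConfig N (d := d) (L := L) β) ε)
                  (fun U => β / N * wilsonAction (fundamentalRep (Fin N)) U) nstep)],
      ∀ (f : GaugeConfig d L (Matrix.specialUnitaryGroup (Fin N) ℂ) → ℝ), Measurable f → ∀ C : ℝ, (∀ U, |f U| ≤ C) →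
      ∀ (μ₀ : Measure (GaugeConfig d L (Matrix.specialUnitaryGroup (Fin N) ℂ))) [IsProbabilityMeasure μ₀] (a b' : ℕ → ℕ),
        Tendsto a atTop atTop → Tendsto b' atTop atTop →
        TendstoInMeasure (Kernel.trajMeasure (X := fun _ : ℕ => GaugeConfig d L (Matrix.specialUnitaryGroup (Fin N) ℂ)) μ₀
              (fun t : ℕ => (P ∘ₖ (sunLeapfrogHMCN (sunCoordι N) (sunCoordι_skew N) ε (Measure.addHaar : Measure (SUNCoords N))
                  (sunKinetic N) (measurable_halfKick_sun N (measurable_sunWilsonForceLaw_coeConfig N (d := d) (L := L) β) ε)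
                  (fun U => β / N * wilsonAction (fundamentalRep (Fin N)) U) nstep)).comap
                (fun h : (i : ↥(Finset.Iic t)) → GaugeConfig d L (Matrix.specialUnitaryGroup (Fin N) ℂ) =>
                  h ⟨t, Finset.mem_Iic.2 le_rfl⟩) (measurable_pi_apply _)))
          (fun (n : ℕ) (x : ℕ → GaugeConfig d L (Matrix.specialUnitaryGroup (Fin N) ℂ)) => ((b' n * a n : ℕ) : ℝ)
            * replicaSEsq (fun j (x : ℕ → GaugeConfig d L (Matrix.specialUnitaryGroup (Fin N) ℂ)) =>
                (∑ i ∈ Finset.range (b' n), f (x (b' n * j + i))) / (b' n)) (a n) x)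
          atTop (fun _ => (∫ y, (f y - ∫ z, f z ∂(wilsonMeasure (d := d) (L := L) (fundamentalRep (Fin N)) (β / N))) ^ 2 ∂(wilsonMeasure (d := d) (L := L) (fundamentalRep (Fin N)) (β / N)))
              + 2 * ∑' k, ∫ y, (f y - ∫ z, f z ∂(wilsonMeasure (d := d) (L := L) (fundamentalRep (Fin N)) (β / N)))
                * (Scoring.kop (P ∘ₖ (sunLeapfrogHMCN (sunCoordι N) (sunCoordι_skew N) ε (Measure.addHaar : Measure (SUNCoords N))
                  (sunKinetic N) (measurable_halfKick_sun N (measurable_sunWilsonForceLaw_coeConfig N (d := d) (L := L) β) ε)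
                  (fun U => β / N * wilsonAction (fundamentalRep (Fin N)) U) nstep)))^[k + 1]
                  (fun y => f y - ∫ z, f z ∂(wilsonMeasure (d := d) (L := L) (fundamentalRep (Fin N)) (β / N))) y ∂(wilsonMeasure (d := d) (L := L) (fundamentalRep (Fin N)) (β / N))) := by
  obtain ⟨τ₀, hτ₀, h⟩ := wilson_sunLeapfrogHMCN_exactStep_certificate N (d := d) (L := L) β
  refine ⟨τ₀, hτ₀, fun nstep ε hn hε hτ P _ hP _ f hf C hC μ₀ _ a b' ha hb' => ?_⟩
  obtain ⟨hinv, m, ε', hm, hε0, hε1, hmin⟩ := h nstep ε hn hε hτ P hP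
  exact Scoring.chain_batchMeans_sigmaHat_tendstoInMeasure_of_nHit hinv (GeneralNCMC.minorised_setwise hmin)
    hε0 hε1 hm hf hC μ₀ ha hb'

/-- **THE BATCH-MEANS INTERVAL OF A FIXED-STEP `'hmc' + 'or'` RUN IS ASYMPTOTICALLY EXACT** (`σ²_f > 0`, any initial
law, `z > 0`): `P_{μ₀}(|√(ab) (f̄_{ab} − π f)| ≤ z σ̂_BM) → (gaussianReal 0 1)[−z, z]`. -/
theorem wilson_sunLeapfrogHMCN_exactStep_batchMeans_coverage :
    ∃ τ₀ : ℝ, 0 < τ₀ ∧ ∀ (nstep : ℕ) (ε : ℝ), 1 ≤ nstep → 0 < ε → nstep * ε ≤ τ₀ →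
      ∀ (P : Kernel (GaugeConfig d L (Matrix.specialUnitaryGroup (Fin N) ℂ)) (GaugeConfig d L (Matrix.specialUnitaryGroup (Fin N) ℂ)))
        [IsMarkovKernel P], Invariant P (wilsonMeasure (d := d) (L := L) (fundamentalRep (Fin N)) (β / N)) →
      ∀ [IsMarkovKernel (sunLeapfrogHMCN (sunCoordι N) (sunCoordι_skew N) ε (Measure.addHaar : Measure (SUNCoords N))
                  (sunKinetic N) (measurable_halfKick_sun N (measurable_sunWilsonForceLaw_coeConfig N (d := d) (L := L) β) ε)
                  (fun U => β / N * wilsonAction (fundamentalRep (Fin N)) U) nstep)],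
      ∀ (f : GaugeConfig d L (Matrix.specialUnitaryGroup (Fin N) ℂ) → ℝ), Measurable f → ∀ C : ℝ, (∀ U, |f U| ≤ C) →
        0 < (∫ y, (f y - ∫ z, f z ∂(wilsonMeasure (d := d) (L := L) (fundamentalRep (Fin N)) (β / N))) ^ 2 ∂(wilsonMeasure (d := d) (L := L) (fundamentalRep (Fin N)) (β / N)))
              + 2 * ∑' k, ∫ y, (f y - ∫ z, f z ∂(wilsonMeasure (d := d) (L := L) (fundamentalRep (Fin N)) (β / N)))
                * (Scoring.kop (P ∘ₖ (sunLeapfrogHMCN (sunCoordι N) (sunCoordι_skew N) ε (Measure.addHaar : Measure (SUNCoords N))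
                  (sunKinetic N) (measurable_halfKick_sun N (measurable_sunWilsonForceLaw_coeConfig N (d := d) (L := L) β) ε)
                  (fun U => β / N * wilsonAction (fundamentalRep (Fin N)) U) nstep)))^[k + 1]
                  (fun y => f y - ∫ z, f z ∂(wilsonMeasure (d := d) (L := L) (fundamentalRep (Fin N)) (β / N))) y ∂(wilsonMeasure (d := d) (L := L) (fundamentalRep (Fin N)) (β / N)) →
      ∀ (μ₀ : Measure (GaugeConfig d L (Matrix.specialUnitaryGroup (Fin N) ℂ))) [IsProbabilityMeasure μ₀] (a b' : ℕ → ℕ),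
        Tendsto a atTop atTop → Tendsto b' atTop atTop → ∀ z : ℝ, 0 < z →
        Tendsto (fun n : ℕ => (Kernel.trajMeasure (X := fun _ : ℕ => GaugeConfig d L (Matrix.specialUnitaryGroup (Fin N) ℂ)) μ₀
              (fun t : ℕ => (P ∘ₖ (sunLeapfrogHMCN (sunCoordι N) (sunCoordι_skew N) ε (Measure.addHaar : Measure (SUNCoords N))
                  (sunKinetic N) (measurable_halfKick_sun N (measurable_sunWilsonForceLaw_coeConfig N (d := d) (L := L) β) ε)
                  (fun U => β / N * wilsonAction (fundamentalRep (Fin N)) U) nstep)).comap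
                (fun h : (i : ↥(Finset.Iic t)) → GaugeConfig d L (Matrix.specialUnitaryGroup (Fin N) ℂ) =>
                  h ⟨t, Finset.mem_Iic.2 le_rfl⟩) (measurable_pi_apply _))).real
          {x | |((Real.sqrt ((b' n * a n : ℕ) : ℝ))⁻¹
              * ∑ t ∈ Finset.range (b' n * a n), (f (x t) - ∫ z, f z ∂(wilsonMeasure (d := d) (L := L) (fundamentalRep (Fin N)) (β / N))))
            / Real.sqrt (((b' n * a n : ℕ) : ℝ)
              * replicaSEsq (fun j (x : ℕ → GaugeConfig d L (Matrix.specialUnitaryGroup (Fin N) ℂ)) =>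
                  (∑ i ∈ Finset.range (b' n), f (x (b' n * j + i))) / (b' n)) (a n) x)| ≤ z})
          atTop (𝓝 ((gaussianReal 0 1).real (Set.Icc (-z) z))) := by
  obtain ⟨τ₀, hτ₀, h⟩ := wilson_sunLeapfrogHMCN_exactStep_certificate N (d := d) (L := L) β
  refine ⟨τ₀, hτ₀, fun nstep ε hn hε hτ P _ hP _ f hf C hC hσ μ₀ _ a b' ha hb' z hz => ?_⟩
  obtain ⟨hinv, m, ε', hm, hε0, hε1, hmin⟩ := h nstep ε hn hε hτ P hP
  exact Scoring.doeblinPower_batchMeans_studentized_coverage hinv hmin hε0 hε1 hm hf hC hσ μ₀ ha hb' hz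

/-- **THE REPORTED `τ̂_int = σ̂²_BM/(2 v̂)` OF A FIXED-STEP `'hmc' + 'or'` RUN IS CONSISTENT** (`Var_π f ≠ 0`, any
initial law): `σ̂²/(2 v̂) → τ_int(ρ_f)` in probability. -/
theorem wilson_sunLeapfrogHMCN_exactStep_tauInt_tendstoInMeasure :
    ∃ τ₀ : ℝ, 0 < τ₀ ∧ ∀ (nstep : ℕ) (ε : ℝ), 1 ≤ nstep → 0 < ε → nstep * ε ≤ τ₀ →
      ∀ (P : Kernel (GaugeConfig d L (Matrix.specialUnitaryGroup (Fin N) ℂ)) (GaugeConfig d L (Matrix.specialUnitaryGroup (Fin N) ℂ)))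
        [IsMarkovKernel P], Invariant P (wilsonMeasure (d := d) (L := L) (fundamentalRep (Fin N)) (β / N)) →
      ∀ [IsMarkovKernel (sunLeapfrogHMCN (sunCoordι N) (sunCoordι_skew N) ε (Measure.addHaar : Measure (SUNCoords N))
                  (sunKinetic N) (measurable_halfKick_sun N (measurable_sunWilsonForceLaw_coeConfig N (d := d) (L := L) β) ε)
                  (fun U => β / N * wilsonAction (fundamentalRep (Fin N)) U) nstep)],
      ∀ (f : GaugeConfig d L (Matrix.specialUnitaryGroup (Fin N) ℂ) → ℝ), Measurable f → ∀ C : ℝ, (∀ U, |f U| ≤ C) →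
        autocov (P ∘ₖ (sunLeapfrogHMCN (sunCoordι N) (sunCoordι_skew N) ε (Measure.addHaar : Measure (SUNCoords N))
                  (sunKinetic N) (measurable_halfKick_sun N (measurable_sunWilsonForceLaw_coeConfig N (d := d) (L := L) β) ε)
                  (fun U => β / N * wilsonAction (fundamentalRep (Fin N)) U) nstep)) (wilsonMeasure (d := d) (L := L) (fundamentalRep (Fin N)) (β / N))
          (fun y => f y - ∫ z, f z ∂(wilsonMeasure (d := d) (L := L) (fundamentalRep (Fin N)) (β / N))) 0 ≠ 0 →
      ∀ (μ₀ : Measure (GaugeConfig d L (Matrix.specialUnitaryGroup (Fin N) ℂ))) [IsProbabilityMeasure μ₀] (a b' : ℕ → ℕ),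
        Tendsto a atTop atTop → Tendsto b' atTop atTop →
        TendstoInMeasure (Kernel.trajMeasure (X := fun _ : ℕ => GaugeConfig d L (Matrix.specialUnitaryGroup (Fin N) ℂ)) μ₀
              (fun t : ℕ => (P ∘ₖ (sunLeapfrogHMCN (sunCoordι N) (sunCoordι_skew N) ε (Measure.addHaar : Measure (SUNCoords N))
                  (sunKinetic N) (measurable_halfKick_sun N (measurable_sunWilsonForceLaw_coeConfig N (d := d) (L := L) β) ε)
                  (fun U => β / N * wilsonAction (fundamentalRep (Fin N)) U) nstep)).comap
                (fun h : (i : ↥(Finset.Iic t)) → GaugeConfig d L (Matrix.specialUnitaryGroup (Fin N) ℂ) =>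
                  h ⟨t, Finset.mem_Iic.2 le_rfl⟩) (measurable_pi_apply _)))
          (fun (n : ℕ) (x : ℕ → GaugeConfig d L (Matrix.specialUnitaryGroup (Fin N) ℂ)) =>
            (((b' n * a n : ℕ) : ℝ)
              * replicaSEsq (fun j (x : ℕ → GaugeConfig d L (Matrix.specialUnitaryGroup (Fin N) ℂ)) =>
                  (∑ i ∈ Finset.range (b' n), f (x (b' n * j + i))) / (b' n)) (a n) x)
            / (2 * ((∑ t ∈ Finset.range (b' n * a n), f (x t) ^ 2) / ((b' n * a n : ℕ) : ℝ)
                - ((∑ t ∈ Finset.range (b' n * a n), f (x t)) / ((b' n * a n : ℕ) : ℝ)) ^ 2)))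
          atTop (fun _ => tauInt (fun t =>
            autocov (P ∘ₖ (sunLeapfrogHMCN (sunCoordι N) (sunCoordι_skew N) ε (Measure.addHaar : Measure (SUNCoords N))
                  (sunKinetic N) (measurable_halfKick_sun N (measurable_sunWilsonForceLaw_coeConfig N (d := d) (L := L) β) ε)
                  (fun U => β / N * wilsonAction (fundamentalRep (Fin N)) U) nstep)) (wilsonMeasure (d := d) (L := L) (fundamentalRep (Fin N)) (β / N))
                (fun y => f y - ∫ z, f z ∂(wilsonMeasure (d := d) (L := L) (fundamentalRep (Fin N)) (β / N))) t
              / autocov (P ∘ₖ (sunLeapfrogHMCN (sunCoordι N) (sunCoordι_skew N) ε (Measure.addHaar : Measure (SUNCoords N))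
                  (sunKinetic N) (measurable_halfKick_sun N (measurable_sunWilsonForceLaw_coeConfig N (d := d) (L := L) β) ε)
                  (fun U => β / N * wilsonAction (fundamentalRep (Fin N)) U) nstep)) (wilsonMeasure (d := d) (L := L) (fundamentalRep (Fin N)) (β / N))
                (fun y => f y - ∫ z, f z ∂(wilsonMeasure (d := d) (L := L) (fundamentalRep (Fin N)) (β / N))) 0)) := by
  obtain ⟨τ₀, hτ₀, h⟩ := wilson_sunLeapfrogHMCN_exactStep_certificate N (d := d) (L := L) β
  refine ⟨τ₀, hτ₀, fun nstep ε hn hε hτ P _ hP _ f hf C hC hvar μ₀ _ a b' ha hb' => ?_⟩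
  obtain ⟨hinv, m, ε', hm, hε0, hε1, hmin⟩ := h nstep ε hn hε hτ P hP
  exact Scoring.chain_batchMeans_tauInt_tendstoInMeasure_of_nHit hinv hmin hε0 hε1 hm hf hC hvar μ₀ ha hb'

end FixedStep

end Summit.Ventures.LatticeQCDFlow.Exactness

end
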